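import Summits.AtomisticToContinuum.HydrodynamicLimit.Theorems.OneFlightGossipEngineEquilibriumClampedCollisionalWindowLDCoinRecordsC1

/-!
# Measurability of the window-clamped radial virials and of window integrals along the flow
(crux `EquilibriumClampedCollisionalWindowLD`, stmt-AtomisticToContinuum-13733; line `radial-virial-polarization`;
stub `stub_measurability` (S6), registered signature verbatim in
`Summit.AtomisticToContinuum.HydrodynamicLimit.Theorems.ClampedTransferCoin.RadialVirial`)

Support file (`--supports stmt-AtomisticToContinuum-13733`) in the vocabulary of
`Theorems/OneFlightGossipEngineEquilibriumClampedCollisionalWindowLDDefs` (`Flow`, `Phase`, `Rec`, `gibbs`, `window`,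
`impulse`, `runAct`, `flagG`, `coinCount`, `coinTime`), continuing the coin-measurability files of the sibling line
(`…WindowLDCoinTimesC1`: the coin guard events `{z ∈ good ∧ n < coinCount}` are measurable and collision sums over the
window decompose into coin sums, `collisionSum_Ioc_eq_sum_range`; `…WindowLDCoinRecordsC1`: on a guard event the
configuration and the records at the coin are measurable, `measurable_flow_coinTime_guard`, `measurable_record_guard`,
`measurable_sum_contactPairs_of_measurable`, `measurable_ite_of_restrict`). No new definitions.

* `measurable_indicator_sum_range` (pure measure theory): a sum `Σ_{n < K(a)} T n a` with a RANDOM number of terms,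
  extended by `0` off an event `s`, is measurable as soon as every guard event `{a ∈ s ∧ n < K a}` is measurable and
  every term is measurable on its guard event — it is the pointwise (eventually constant) limit of the measurable
  partial sums of the guarded terms (`measurable_of_tendsto_metrizable`).
* `measurable_indicator_collisionSum_window`: for every MEASURABLE functional `F` of the record (no continuity: the
  velocity-jump engine of `EmpiricalCollisionMeasureMeasurable` needs continuous marks, the coin enumeration does
  not), `z ↦ Σ_{collisions in (0, w]} F(record)`, extended by `0` off the good set, is measurable in the datum; hence
  so are the running transfer activities at the END of the window (`measurable_indicator_runAct_window`) and the
  window-global clamps `flagG` on the good set (`measurable_flagG_good`).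
* `measurable_indicator_clampedSum`: the window-CLAMPED collision sums `z ↦ Σ_{records in (0, w]} ω_fst(z) ω_snd(z) G(c) / 2`
  (the summand depends on the datum ALSO through the clamps) are measurable after extension by `0`: coin
  decomposition, then products of the measurable clamps with the measurable records at the coins.
* `stub_measurability_virial` / `stub_measurability_integral` / `RadialVirial.stub_measurability`: under the Gibbs
  law (carried by the good set: `localGibbsLaw_absolutelyContinuous` and `Φ.measure_compl_good`) the clamped radial
  virials `Σ ω ω Γ(c) ‖Δv_fst‖ / 2` with measurable record weight `Γ` are a.e.-measurable (clause (a)), and the window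
  integrals `∫₀ʷ F(Φ_r z) dr` of continuous observables are a.e.-measurable (clause (b), by the joint measurability
  of the torus flow on its good set, `HardSphereFlow.aemeasurable_intervalIntegral_comp_flow_torus`).

Hypothesis `0 < σ < 1/2` throughout (hard-sphere regularity of the torus geometry at diameter `ε_N ≤ σ`).
-/

noncomputable section

open MeasureTheory Set Filter
open scoped ENNReal BigOperators
open Literature.Analysis.FluidPDE Literature.MathematicalPhysics.KineticTheory
open Literature.Analysis.FunctionSpaces (Torus.partialDeriv Torus.IsSmooth)

namespace Summit.AtomisticToContinuum.HydrodynamicLimit.Theorems.ClampedTransferCoin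

/-! ## A sum with a random number of terms -/

/-- **Sums with a random number of terms are measurable.** If every guard event `{a ∈ s ∧ n < K a}` is measurable
and every term `T n` is measurable on its guard event, then `a ↦ Σ_{n < K a} T n a`, extended by `0` off `s`, is
measurable: it is the pointwise limit (eventually constant in the rank) of the partial sums of the guarded terms. -/
theorem measurable_indicator_sum_range {α : Type*} [MeasurableSpace α] {s : Set α} {K : α → ℕ}
    {T : ℕ → α → ℝ} (hK : ∀ n, MeasurableSet {a | a ∈ s ∧ n < K a})
    (hT : ∀ n, Measurable fun a : {a // a ∈ s ∧ n < K a} => T n a.1) :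
    Measurable (s.indicator fun a => ∑ n ∈ Finset.range (K a), T n a) := by
  classical
  have hu : ∀ n, Measurable fun a => if a ∈ s ∧ n < K a then T n a else 0 :=
    fun n => measurable_ite_of_restrict (hK n) (hT n) 0
  refine measurable_of_tendsto_metrizable
    (f := fun M a => ∑ n ∈ Finset.range M, if a ∈ s ∧ n < K a then T n a else 0)
    (fun M => Finset.measurable_sum _ fun n _ => hu n) ?_
  rw [tendsto_pi_nhds]
  intro a
  by_cases ha : a ∈ s
  · rw [Set.indicator_of_mem ha]
    refine tendsto_atTop_of_eventually_const (i₀ := K a) fun M hM => ?_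
    have h1 : ∑ n ∈ Finset.range (K a), T n a =
        ∑ n ∈ Finset.range (K a), if a ∈ s ∧ n < K a then T n a else 0 :=
      Finset.sum_congr rfl fun n hn => (if_pos ⟨ha, Finset.mem_range.1 hn⟩).symm
    rw [h1]
    exact (Finset.sum_subset (Finset.range_subset_range.2 hM) fun n _ hn =>
      if_neg fun h => hn (Finset.mem_range.2 h.2)).symm
  · rw [Set.indicator_of_notMem ha]
    exact tendsto_atTop_of_eventually_const (i₀ := 0) fun M _ =>
      Finset.sum_eq_zero fun n _ => if_neg fun h => ha h.1

/-! ## Collision sums of measurable functionals over the window -/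

variable {σ : ℝ} {N : ℕ}

/-- On the guard event of the `n`-th coin, the sum over the ordered contact pairs at the coin of a MEASURABLE
functional of the record is measurable in the datum. -/
theorem measurable_coinSum_guard (hσ : 0 < σ) (hσ2 : σ < 1 / 2) (τ : ℝ) (Φ : Flow σ N) (n : ℕ)
    {F : Rec N → ℝ} (hF : Measurable F) :
    Measurable fun z : {z : Phase N // z ∈ Φ.good ∧ n < coinCount σ τ Φ z} =>
      ∑ p ∈ contactPairs (Torus.geometry (Fin 3)) (hsDiameter σ N) (Φ.flow (coinTime Φ z.1 n) z.1),
        F (HardSphereCollisionRecord.ofConfig (Torus.geometry (Fin 3)) (hsDiameter σ N)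
          (Φ.flow (coinTime Φ z.1 n) z.1) (coinTime Φ z.1 n) p.1 p.2) :=
  measurable_sum_contactPairs_of_measurable (measurable_flow_coinTime_guard hσ hσ2 τ Φ le_rfl) fun p =>
    hF.comp (measurable_record_guard hσ hσ2 τ Φ le_rfl p.1 p.2)

/-- **Collision sums over the window of measurable functionals are measurable in the datum** (extended by `0`
off the good set): coin decomposition `collisionSum_Ioc_eq_sum_range` and `measurable_indicator_sum_range`. -/
theorem measurable_indicator_collisionSum_window (hσ : 0 < σ) (hσ2 : σ < 1 / 2) (τ : ℝ) (Φ : Flow σ N)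
    {F : Rec N → ℝ} (hF : Measurable F) :
    Measurable (Φ.good.indicator fun z => Φ.collisionSum (Set.Ioc 0 (window τ N)) F z) := by
  have heq : (Φ.good.indicator fun z => Φ.collisionSum (Set.Ioc 0 (window τ N)) F z) =
      Φ.good.indicator fun z => ∑ n ∈ Finset.range (coinCount σ τ Φ z),
        ∑ p ∈ contactPairs (Torus.geometry (Fin 3)) (hsDiameter σ N) (Φ.flow (coinTime Φ z n) z),
          F (HardSphereCollisionRecord.ofConfig (Torus.geometry (Fin 3)) (hsDiameter σ N)
            (Φ.flow (coinTime Φ z n) z) (coinTime Φ z n) p.1 p.2) :=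
    Set.indicator_congr fun z hz => collisionSum_Ioc_eq_sum_range Φ hz (window τ N) F
  rw [heq]
  exact measurable_indicator_sum_range (measurableSet_coinGuard hσ hσ2 τ Φ)
    fun n => measurable_coinSum_guard hσ hσ2 τ Φ n hF

/-- The activity summand of particle `i`, `c ↦ 1{c.fst = i} · impulse c`, is a measurable functional of the record. -/
theorem measurable_ite_fst_impulse (i : Fin (N + 1)) :
    Measurable fun c : Rec N => if c.fst = i then impulse c else 0 :=
  Measurable.ite (HardSphereCollisionRecord.measurable_indices.fst (measurableSet_singleton i))
    measurable_impulse measurable_const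

/-- **The running transfer activity at the end of the window is measurable in the datum** (extended by `0` off
the good set). -/
theorem measurable_indicator_runAct_window (hσ : 0 < σ) (hσ2 : σ < 1 / 2) (τ : ℝ) (Φ : Flow σ N)
    (i : Fin (N + 1)) : Measurable (Φ.good.indicator (runAct σ τ Φ (window τ N) i)) := by
  have heq : Φ.good.indicator (runAct σ τ Φ (window τ N) i) = fun z =>
      σ / τ * Φ.good.indicator (fun z => Φ.collisionSum (Set.Ioc 0 (window τ N))
        (fun c => if c.fst = i then impulse c else 0) z) z := by
    funext z
    by_cases hz : z ∈ Φ.good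
    · simp only [Set.indicator_of_mem hz, runAct]
    · simp only [Set.indicator_of_notMem hz, mul_zero]
  rw [heq]
  exact (measurable_indicator_collisionSum_window hσ hσ2 τ Φ (measurable_ite_fst_impulse i)).const_mul _

/-- **The window-global clamp `ω_i = 1{act_i ≤ V}` is measurable in the datum on the good set.** -/
theorem measurable_flagG_good (hσ : 0 < σ) (hσ2 : σ < 1 / 2) (τ V : ℝ) (Φ : Flow σ N) (i : Fin (N + 1)) :
    Measurable fun z : Φ.good => flagG σ τ V Φ i z := by
  have heq : (fun z : Φ.good => flagG σ τ V Φ i z) = fun z : Φ.good =>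
      if Φ.good.indicator (runAct σ τ Φ (window τ N) i) z ≤ V then (1 : ℝ) else 0 := by
    funext z
    rw [flagG, Set.indicator_of_mem z.2]
  rw [heq]
  exact Measurable.ite (measurableSet_le ((measurable_indicator_runAct_window hσ hσ2 τ Φ i).comp
    measurable_subtype_coe) measurable_const) measurable_const measurable_const

/-! ## Window-clamped collision sums -/

/-- **Window-CLAMPED collision sums are measurable in the datum** (extended by `0` off the good set): for every
measurable functional `G` of the record, `z ↦ Σ_{records c in (0, w]} ω_{c.fst}(z) ω_{c.snd}(z) G(c) / 2` — the
summand depends on the datum also through the window-global clamps — is measurable: by the coin decomposition it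
is `Σ_{n < coinCount} Σ_{(i,j) at coin n} ω_i ω_j G(record) / 2`, a sum with a random number of terms each of which
is a finite sum of products of measurable functions on its guard event. -/
theorem measurable_indicator_clampedSum (hσ : 0 < σ) (hσ2 : σ < 1 / 2) (τ V : ℝ) (Φ : Flow σ N)
    {G : Rec N → ℝ} (hG : Measurable G) :
    Measurable (Φ.good.indicator fun z => Φ.collisionSum (Set.Ioc 0 (window τ N))
      (fun c => flagG σ τ V Φ c.fst z * flagG σ τ V Φ c.snd z * G c / 2) z) := by
  have heq : (Φ.good.indicator fun z => Φ.collisionSum (Set.Ioc 0 (window τ N))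
      (fun c => flagG σ τ V Φ c.fst z * flagG σ τ V Φ c.snd z * G c / 2) z) =
      Φ.good.indicator fun z => ∑ n ∈ Finset.range (coinCount σ τ Φ z),
        ∑ p ∈ contactPairs (Torus.geometry (Fin 3)) (hsDiameter σ N) (Φ.flow (coinTime Φ z n) z),
          flagG σ τ V Φ p.1 z * flagG σ τ V Φ p.2 z *
            G (HardSphereCollisionRecord.ofConfig (Torus.geometry (Fin 3)) (hsDiameter σ N)
              (Φ.flow (coinTime Φ z n) z) (coinTime Φ z n) p.1 p.2) / 2 := by
    refine Set.indicator_congr fun z hz => ?_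
    rw [collisionSum_Ioc_eq_sum_range Φ hz]
    simp only [HardSphereCollisionRecord.ofConfig_fst, HardSphereCollisionRecord.ofConfig_snd, coinCount_eq]
  rw [heq]
  refine measurable_indicator_sum_range (measurableSet_coinGuard hσ hσ2 τ Φ) fun n => ?_
  refine measurable_sum_contactPairs_of_measurable (measurable_flow_coinTime_guard hσ hσ2 τ Φ le_rfl)
    fun p => ?_
  have hinc : Measurable fun z : {z : Phase N // z ∈ Φ.good ∧ n < coinCount σ τ Φ z} =>
      (⟨z.1, z.2.1⟩ : Φ.good) :=
    measurable_subtype_coe.subtype_mk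
  exact ((((measurable_flagG_good hσ hσ2 τ V Φ p.1).comp hinc).mul
    ((measurable_flagG_good hσ hσ2 τ V Φ p.2).comp hinc)).mul
    (hG.comp (measurable_record_guard hσ hσ2 τ Φ le_rfl p.1 p.2))).div_const 2

/-- From measurability after extension by `0` off the good set to a.e.-measurability under a law carried by the
good set. -/
theorem aemeasurable_of_measurable_indicator_good (Φ : Flow σ N) {W : Phase N → ℝ}
    (hW : Measurable (Φ.good.indicator W)) {μ : Measure (Phase N)} (hμ : μ Φ.goodᶜ = 0) :
    AEMeasurable W μ := by
  refine ⟨_, hW, ?_⟩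
  have hae : ∀ᵐ z ∂μ, z ∈ Φ.good := by
    rw [ae_iff]
    exact hμ
  filter_upwards [hae] with z hz
  exact (Set.indicator_of_mem hz W).symm

/-- The Gibbs law is carried by the good set of the flow. -/
theorem gibbs_compl_good (σ a₀ θ₀ : ℝ) (u₀ : V3) (N : ℕ) (Φ : Flow σ N) :
    gibbs σ a₀ θ₀ u₀ N Φ Φ.goodᶜ = 0 :=
  localGibbsLaw_absolutelyContinuous σ _ _ _ N Φ Φ.measure_compl_good

/-- **S6 (a) · the clamped radial virials are a.e.-measurable under the Gibbs law**: for every measurable record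
weight `Γ`, `z ↦ Σ_{records in (0, w]} ω_fst(z) ω_snd(z) Γ(c) ‖v_fst⁺ − v_fst⁻‖ / 2` is `G_N`-a.e. measurable. -/
theorem stub_measurability_virial (hσ : 0 < σ) (hσ2 : σ < 1 / 2) (τ V a₀ θ₀ : ℝ) (u₀ : V3) (Φ : Flow σ N)
    {Γ : Rec N → ℝ} (hΓ : Measurable Γ) :
    AEMeasurable (fun z => Φ.collisionSum (Set.Ioc 0 (window τ N))
      (fun c => flagG σ τ V Φ c.fst z * flagG σ τ V Φ c.snd z * (Γ c * ‖c.postVel.1 - c.preVel.1‖) / 2) z)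
      (gibbs σ a₀ θ₀ u₀ N Φ) :=
  aemeasurable_of_measurable_indicator_good Φ
    (measurable_indicator_clampedSum hσ hσ2 τ V Φ (G := fun c => Γ c * ‖c.postVel.1 - c.preVel.1‖)
      (hΓ.mul (HardSphereCollisionRecord.measurable_postVel.fst.sub
        HardSphereCollisionRecord.measurable_preVel.fst).norm))
    (gibbs_compl_good σ a₀ θ₀ u₀ N Φ)

/-- **S6 (b) · window integrals of continuous observables along the flow are a.e.-measurable under the Gibbs
law** (joint measurability of the torus flow on its good set). -/
theorem stub_measurability_integral (σ τ a₀ θ₀ : ℝ) (u₀ : V3) (Φ : Flow σ N) {F : Phase N → ℝ}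
    (hF : Continuous F) :
    AEMeasurable (fun z => ∫ r in (0 : ℝ)..window τ N, F (Φ.flow r z)) (gibbs σ a₀ θ₀ u₀ N Φ) :=
  Φ.aemeasurable_intervalIntegral_comp_flow_torus hF.measurable 0 (window τ N) (gibbs_compl_good σ a₀ θ₀ u₀ N Φ)

namespace RadialVirial

/-- **S6 · MEASURABILITY** (registered stub of the line `radial-virial-polarization`). Under the Gibbs law, for
`0 < σ < 1/2` and `0 < τ`: (a) the clamped radial virial with any measurable record weight `Γ` is a.e.-measurable
in the datum; (b) window integrals of continuous observables along the flow are a.e.-measurable. -/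
theorem stub_measurability :
    ∀ (σ τ V a₀ θ₀ : ℝ) (u₀ : V3), 0 < σ → σ < 1 / 2 → 0 < τ → ∀ (N : ℕ) (Φ : Flow σ N),
      (∀ Γ : Rec N → ℝ, Measurable Γ →
        AEMeasurable (fun z => Φ.collisionSum (Set.Ioc 0 (window τ N))
          (fun c => flagG σ τ V Φ c.fst z * flagG σ τ V Φ c.snd z * (Γ c * ‖c.postVel.1 - c.preVel.1‖) / 2) z)
          (gibbs σ a₀ θ₀ u₀ N Φ)) ∧
      (∀ F : Phase N → ℝ, Continuous F →
        AEMeasurable (fun z => ∫ r in (0 : ℝ)..window τ N, F (Φ.flow r z)) (gibbs σ a₀ θ₀ u₀ N Φ)) :=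
  fun σ τ V a₀ θ₀ u₀ hσ hσ2 _ _ Φ =>
    ⟨fun _ hΓ => stub_measurability_virial hσ hσ2 τ V a₀ θ₀ u₀ Φ hΓ,
      fun _ hF => stub_measurability_integral σ τ a₀ θ₀ u₀ Φ hF⟩

end RadialVirial

end Summit.AtomisticToContinuum.HydrodynamicLimit.Theorems.ClampedTransferCoin

end
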